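import Literature.MathematicalPhysics.QuantumLattice.HubbardOpenBoxEDCertificateKronecker
import HarnessLib

/-!
# Packed sector rows of a GENERAL integer-coded cluster Hamiltonian (coded cluster oracles)

Topic `MathematicalPhysics/QuantumLattice`, family `hubbard`. The data-free kernel exact-diagonalisation
floor chain of the tree (`HubbardOpenBoxSectorRows` §3, `HubbardOpenBoxEDCertificateKronecker`,
`…KroneckerSwap`, `…KroneckerBlocks`) is written for ONE cluster Hamiltonian, the uniform open
`t–t'` box `hubbardOpenBoxTT' a b (TN/Q) (TD/Q) (UU/Q)` with its coded entry function `hzInt`. This file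
and its two companions (`HubbardOpenBoxCodedClusterCertificate`, `…CertificateBlocks`) make the chain
GENERIC over a **coded cluster oracle** `O : CodedCluster` — the coded application
`O.app m f = (Q·H φ_f)(m)` of the (integer-scaled) cluster Hamiltonian to a coded vector `φ_f = f ∘ code`
(Lin–Gubernatis 1993 §II: the Hamiltonian applied on the fly to a vector addressed by occupation codes)
and an a-priori bound `O.bound` on the integer entries — so that the SAME kernel checker and the SAME
soundness theorem serve every sector-preserving cluster Hamiltonian on the open `a × b` box that has an
occupation-code dictionary: the weighted Anderson clusters `hubbardOpenBoxTT'W` of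
Valentí–Stolze–Hirschfeld (dictionary `hubbardOpenBoxTT'W_apply_eq_hzIntW`), the `t–t'–t''` clusters
`hubbardOpenBoxTT'T''`, and the uniform `t–t'` cluster itself.

* §1 `CodedCluster` (the computable data the kernel evaluates) and its SEMANTICS `CodedCluster.Models a b hz Q H`:
  the five matrix-level facts the soundness proof uses — the entry dictionary `H s s' = hz (code s) (code s')/Q`,
  the vector dictionary `(H φ_f)(s) = O.app (code s) f / Q`, sector preservation, symmetry of `hz` on
  configurations, and `|hz| ≤ O.bound`.
* §2 the generic packed rows: `O.rowH y RT m = O.app m (2^{y·rank})`, **`rowH_eq_sum`**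
  (`O.rowH y RT L[i] = Σ_j hz L[i] L[j] · 2^{y j}` on a checked sector list — `H` preserves the sector, the
  sector sum is transferred to the positions of `L`), the offset scaled rows `O.rowA`, their fields
  **`entry_rowA`** (`= K·(hz L[i] L[j] − c·δ_ij)`, no carries under `K·(bound + |c|) < 2^{y-1}`), and the row
  lists `O.rowsA` with their length / entry lemmas.

Everything is proved; no named fact; nothing numerical is asserted here.

## References

* H. Q. Lin, J. E. Gubernatis, Comput. Phys. 7 (1993) 400, §II (bit-coded sector bases addressed by
  position; Hamiltonian applied on the fly). [cite: LinGubernatis1993, §II]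
* D. Harvey, J. Symb. Comput. 44 (2009) 1502, §3.1 (Kronecker substitution at `2^N`). [cite: Harvey2009, §3.1]
* R. Valentí, J. Stolze, P. J. Hirschfeld, Phys. Rev. B 43 (1991) 13743, §II (weighted cluster covers).
  [cite: ValentiStolzeHirschfeld1991, §II]
-/

namespace Literature.MathematicalPhysics.QuantumLattice

namespace OccupationCode

open Finset Matrix Literature.Computation.Certificates

/-! ### §1 Coded cluster oracles and their semantics -/

/-- **A coded cluster oracle**: the coded application `app m f = (Q·H φ_f)(m)` of an integer-scaled cluster
Hamiltonian to the coded vector `φ_f = f ∘ code` (integer arithmetic, structural loops — the kernel evaluates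
it), and an a-priori bound on the integer entries of `Q·H` (keeps packed digits from carrying).
[cite: LinGubernatis1993, §II] -/
structure CodedCluster where
  /-- coded application of `Q·H` to a coded vector, at a code -/
  app : ℕ → (ℕ → ℤ) → ℤ
  /-- a-priori bound on the integer entries `|Q·H s s'|` -/
  bound : ℕ

namespace CodedCluster

variable (O : CodedCluster)

/-- **Semantics of a coded cluster oracle.** `O.Models a b hz Q H`: on the open `a × b` box the matrix `H`
has the integer-coded entries `hz (code s) (code s') / Q`, its action on coded vectors is `O.app / Q`, it
preserves the spin sectors `(N↑, N↓)`, `hz` is symmetric on configurations, and `|hz| ≤ O.bound`.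
[cite: LinGubernatis1993, §II] -/
structure Models (O : CodedCluster) (a b : ℕ) (hz : ℕ → ℕ → ℤ) (Q : ℕ)
    (H : Matrix (Finset (Orb (Fin a ×ₗ Fin b))) (Finset (Orb (Fin a ×ₗ Fin b))) ℂ) : Prop where
  /-- entry dictionary -/
  apply_eq : ∀ s s' : Finset (Orb (Fin a ×ₗ Fin b)), H s s' = ((hz (code s) (code s') : ℝ) : ℂ) / ((Q : ℝ) : ℂ)
  /-- vector dictionary -/
  mulVec_eq : ∀ (f : ℕ → ℤ) (s : Finset (Orb (Fin a ×ₗ Fin b))),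
    (H *ᵥ codedVec f) s = ((O.app (code s) f : ℝ) : ℂ) / ((Q : ℝ) : ℂ)
  /-- `H` is block diagonal in the spin sectors -/
  preserves : PreservesSectors H
  /-- symmetry of the coded entries on configurations -/
  symm : ∀ s s' : Finset (Orb (Fin a ×ₗ Fin b)), hz (code s) (code s') = hz (code s') (code s)
  /-- a-priori entry bound -/
  abs_le : ∀ m m' : ℕ, |hz m m'| ≤ (O.bound : ℤ)

/-! ### §2 Generic packed rows -/

/-- **The packed row** of the oracle: `Q·H` applied to `m' ↦ 2^{y·rank m'}` at the code `m`
(`rank` read from the rank table `RT`). [cite: LinGubernatis1993, §II] [cite: Harvey2009, §3.1] -/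
def rowH (y RT m : ℕ) : ℤ := O.app m (shiftF y RT)

/-- The offset packed row `i` of `K·(hz − c·1)`: `K·rowH − K c·2^{y i} + OA·G` with `G = Σ_{j<n} 2^{y j}`
(`OA` the digit offset), as a natural number. [cite: Harvey2009, §3.1] -/
def rowA (K : ℕ) (c : ℤ) (y OA G RT m i : ℕ) : ℕ :=
  ((K : ℤ) * O.rowH y RT m - (K : ℤ) * c * (((1 <<< (y * i) : ℕ) : ℤ)) + (OA : ℤ) * (G : ℤ)).toNat

/-- The offset packed rows along the code list (positions from `i₀`). [cite: LinGubernatis1993, §II] -/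
def rowsA (K : ℕ) (c : ℤ) (y OA G RT : ℕ) : List ℕ → ℕ → List ℕ
  | [], _ => []
  | m :: rest, i => O.rowA K c y OA G RT m i :: rowsA K c y OA G RT rest (i + 1)

/-- Length of the packed-row list (one packed row per code of the sector list). [cite: LinGubernatis1993, §II] -/
theorem length_rowsA (K : ℕ) (c : ℤ) (y OA G RT : ℕ) :
    ∀ (L : List ℕ) (i : ℕ), (O.rowsA K c y OA G RT L i).length = L.length
  | [], _ => rfl
  | m :: rest, i => by simp [rowsA, length_rowsA K c y OA G RT rest (i + 1)]

/-- Entries of the packed-row list: the `k`-th member is the packed row of the `k`-th code. [cite: LinGubernatis1993, §II] -/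
theorem getD_rowsA (K : ℕ) (c : ℤ) (y OA G RT : ℕ) :
    ∀ (L : List ℕ) (i₀ k : ℕ) (hk : k < L.length),
      (O.rowsA K c y OA G RT L i₀).getD k 0 = O.rowA K c y OA G RT L[k] (i₀ + k)
  | [], _, k, hk => absurd hk (Nat.not_lt_zero k)
  | m :: rest, i₀, 0, _ => by simp [rowsA]
  | m :: rest, i₀, k + 1, hk => by
      simp only [rowsA, List.getD_cons_succ, List.getElem_cons_succ]
      rw [getD_rowsA K c y OA G RT rest (i₀ + 1) k (by simpa using hk)]
      simp only [add_assoc, add_comm 1 k]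

section Rows

variable {O} {a b : ℕ} {hz : ℕ → ℕ → ℤ} {Q : ℕ}
  {H : Matrix (Finset (Orb (Fin a ×ₗ Fin b))) (Finset (Orb (Fin a ×ₗ Fin b))) ℂ}

/-- **The packed row is the row**: for a checked sector list `L` with its rank table,
`O.rowH y RT L[i] = Σ_j hz L[i] L[j] · 2^{y j}` (`H` preserves the spin sector, so `H e_i` is supported on
`L`; the sector sum is transferred to the positions of `L`). [cite: LinGubernatis1993, §II] [cite: Harvey2009, §3.1] -/
theorem rowH_eq_sum (hM : O.Models a b hz Q H) (hQ : 0 < Q) {p q : ℕ} {L : List ℕ}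
    (hL : sectorListOK a b p q L = true) {y RT : ℕ} (hRT : rankOK RT L 0 = true) (i : Fin L.length) :
    O.rowH y RT L[i] = ∑ j : Fin L.length, hz L[i] L[j] * ((2 ^ y : ℕ) : ℤ) ^ (j : ℕ) := by
  set s : Finset (Orb (Fin a ×ₗ Fin b)) := decode L[i] with hs
  have hcode : code s = L[i] := code_decode (lt_of_mem_of_ok hL (List.getElem_mem i.isLt))
  have hsec : s ∈ sectorConfigs a b p q := decode_getElem_mem_sectorConfigs_of_ok hL i
  have hQ' : ((Q : ℝ) : ℂ) ≠ 0 := by exact_mod_cast hQ.ne'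
  -- the vector dictionary at `f = shiftF y RT`
  have hmul := hM.mulVec_eq (shiftF y RT) s
  rw [hcode] at hmul
  -- the matrix side: restrict the sum to the sector, then transfer to the list
  have hmv : (H *ᵥ codedVec (shiftF y RT)) s =
      (∑ j : Fin L.length, ((hz L[i] L[j] * ((2 ^ y : ℕ) : ℤ) ^ (j : ℕ) : ℤ) : ℂ)) / ((Q : ℝ) : ℂ) := by
    rw [mulVec, dotProduct]
    have hzero : ∀ s' : Finset (Orb (Fin a ×ₗ Fin b)), s' ∉ sectorConfigs a b p q →
        H s s' * codedVec (shiftF y RT) s' = 0 := by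
      intro s' hs'
      have h0 : H s s' = 0 := by
        by_contra hne
        have hp := hM.preserves s s' hne
        have hs1 := mem_sectorConfigs.1 hsec
        exact hs' (mem_sectorConfigs.2 ⟨hp.1 ▸ hs1.1, hp.2 ▸ hs1.2⟩)
      rw [h0, zero_mul]
    rw [← Finset.sum_subset (Finset.subset_univ (sectorConfigs a b p q)) (fun s' _ hs' => hzero s' hs'),
      sum_sectorConfigs_eq_sum_fin_of_ok hL, Finset.sum_div]
    refine Finset.sum_congr rfl fun j _ => ?_
    have hcj : code (decode L[j] : Finset (Orb (Fin a ×ₗ Fin b))) = L[j] :=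
      code_decode (lt_of_mem_of_ok hL (List.getElem_mem j.isLt))
    rw [hM.apply_eq, codedVec, hcode, hcj, shiftF_eq, powF, rankOf_getElem hRT j]
    push_cast
    ring
  rw [hmv] at hmul
  have h2 : ((∑ j : Fin L.length, hz L[i] L[j] * ((2 ^ y : ℕ) : ℤ) ^ (j : ℕ) : ℤ) : ℂ) =
      ((O.rowH y RT L[i] : ℤ) : ℂ) := by
    rw [Int.cast_sum, rowH]
    have := (div_left_inj' hQ').1 hmul
    rw [this]
    norm_cast
  exact_mod_cast h2.symm

/-- `Σ_{j<n} Y^j = geomNat Y n`. [folklore] -/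
private theorem geomNat_eq' (Y : ℕ) : ∀ n, geomNat Y n = ∑ j ∈ range n, Y ^ j
  | 0 => by simp [geomNat]
  | n + 1 => by rw [geomNat, geomNat_eq' Y n, Finset.sum_range_succ]

/-- **The fields of the packed row are the shifted scaled entries**: with `OA = 2^{y-1}` and
`K·(O.bound + |c|) < 2^{y-1}`, field `j < n` of `O.rowA K c y OA G RT L[i] i` (`G = geomNat (2^y) n`) is
`K·(hz L[i] L[j] − c·δ_ij)`. [cite: Harvey2009, §3.1] -/
theorem entry_rowA (hM : O.Models a b hz Q H) (hQ : 0 < Q) {p q : ℕ} {L : List ℕ}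
    (hL : sectorListOK a b p q L = true) {y : ℕ} (hy : 1 ≤ y) {RT : ℕ} (hRT : rankOK RT L 0 = true)
    {K : ℕ} {c : ℤ} (hK : K * (O.bound + c.natAbs) < 2 ^ (y - 1)) (i j : Fin L.length) :
    PSD.Packed.entry y (O.rowA K c y (2 ^ (y - 1)) (geomNat (2 ^ y) L.length) RT L[i] i) j =
      (K : ℤ) * (hz L[i] L[j] - if i = j then c else 0) := by
  have hYO : (2 : ℕ) ^ y = 2 * 2 ^ (y - 1) := by
    rw [← pow_succ']; congr 1; omega
  have hYpos : 0 < (2 : ℕ) ^ y := Nat.two_pow_pos y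
  -- the shifted scaled entries and their offset digits
  have hAbound : ∀ j : Fin L.length,
      |(K : ℤ) * (hz L[i] L[j] - if i = j then c else 0)| < ((2 ^ (y - 1) : ℕ) : ℤ) := by
    intro j
    have h1 := hM.abs_le L[i] L[j]
    have h2 : |hz L[i] L[j] - if i = j then c else 0| ≤ (O.bound : ℤ) + c.natAbs := by
      refine (abs_sub _ _).trans (add_le_add h1 ?_)
      split_ifs
      · exact le_of_eq (Int.natCast_natAbs c).symm
      · simp
    have hK' : ((K * (O.bound + c.natAbs) : ℕ) : ℤ) < ((2 ^ (y - 1) : ℕ) : ℤ) := by exact_mod_cast hK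
    calc |(K : ℤ) * (hz L[i] L[j] - if i = j then c else 0)|
        = (K : ℤ) * |hz L[i] L[j] - if i = j then c else 0| := by
            rw [abs_mul, abs_of_nonneg (Int.natCast_nonneg K)]
      _ ≤ (K : ℤ) * ((O.bound : ℤ) + c.natAbs) := mul_le_mul_of_nonneg_left h2 (Int.natCast_nonneg K)
      _ < ((2 ^ (y - 1) : ℕ) : ℤ) := by push_cast at hK' ⊢; linarith
  let A : Fin L.length → ℤ := fun j => (K : ℤ) * (hz L[i] L[j] - if i = j then c else 0)
  have hA : ∀ j, A j = (K : ℤ) * (hz L[i] L[j] - if i = j then c else 0) := fun j => rfl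
  let d : ℕ → ℕ := fun j => if h : j < L.length then (A ⟨j, h⟩ + ((2 ^ (y - 1) : ℕ) : ℤ)).toNat else 0
  have hdcast' : ∀ (j : ℕ) (hj : j < L.length), ((d j : ℕ) : ℤ) = A ⟨j, hj⟩ + ((2 ^ (y - 1) : ℕ) : ℤ) := by
    intro j hj
    show (((if h : j < L.length then (A ⟨j, h⟩ + ((2 ^ (y - 1) : ℕ) : ℤ)).toNat else 0 : ℕ) : ℕ) : ℤ) = _
    rw [dif_pos hj]
    have := hAbound ⟨j, hj⟩
    rw [← hA, abs_lt] at this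
    rw [Int.toNat_of_nonneg (by linarith)]
  have hdcast : ∀ j : Fin L.length, ((d j : ℕ) : ℤ) = A j + ((2 ^ (y - 1) : ℕ) : ℤ) :=
    fun j => hdcast' j j.isLt
  have hdlt : ∀ j < L.length, d j < 2 ^ y := by
    intro j hj
    have := hAbound ⟨j, hj⟩
    rw [← hA, abs_lt] at this
    have h2 : ((d j : ℕ) : ℤ) < ((2 ^ y : ℕ) : ℤ) := by
      rw [hdcast' j hj, hYO]
      push_cast at this ⊢
      linarith
    exact_mod_cast h2
  -- the packed row as the digit expansion
  have hpow : (((1 <<< (y * (i : ℕ)) : ℕ) : ℤ)) = ((2 ^ y : ℕ) : ℤ) ^ (i : ℕ) := by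
    rw [Nat.one_shiftLeft, pow_mul]; push_cast; ring
  have hsum : (K : ℤ) * O.rowH y RT L[i] - (K : ℤ) * c * ((2 ^ y : ℕ) : ℤ) ^ (i : ℕ)
      + ((2 ^ (y - 1) : ℕ) : ℤ) * (geomNat (2 ^ y) L.length : ℤ) =
      ∑ j : Fin L.length, (A j + ((2 ^ (y - 1) : ℕ) : ℤ)) * ((2 ^ y : ℕ) : ℤ) ^ (j : ℕ) := by
    rw [rowH_eq_sum hM hQ hL hRT i, geomNat_eq', Finset.mul_sum, Nat.cast_sum, Finset.mul_sum,
      ← Fin.sum_univ_eq_sum_range (fun j => ((2 ^ (y - 1) : ℕ) : ℤ) * (((2 ^ y) ^ j : ℕ) : ℤ))]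
    have hdiag : (K : ℤ) * c * ((2 ^ y : ℕ) : ℤ) ^ (i : ℕ) =
        ∑ j : Fin L.length, (K : ℤ) * (if i = j then c else 0) * ((2 ^ y : ℕ) : ℤ) ^ (j : ℕ) := by
      rw [Finset.sum_eq_single i (fun j _ hj => by rw [if_neg (Ne.symm hj)]; ring) (by simp)]
      rw [if_pos rfl]
    rw [hdiag, ← Finset.sum_sub_distrib, ← Finset.sum_add_distrib]
    refine Finset.sum_congr rfl fun j _ => ?_
    rw [hA]; push_cast; ring
  have hnn : 0 ≤ (K : ℤ) * O.rowH y RT L[i] - (K : ℤ) * c * ((2 ^ y : ℕ) : ℤ) ^ (i : ℕ)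
      + ((2 ^ (y - 1) : ℕ) : ℤ) * (geomNat (2 ^ y) L.length : ℤ) := by
    rw [hsum]
    exact Finset.sum_nonneg fun j _ => mul_nonneg (by rw [← hdcast j]; exact Int.natCast_nonneg _)
      (pow_nonneg (Int.natCast_nonneg _) _)
  have hrowN : O.rowA K c y (2 ^ (y - 1)) (geomNat (2 ^ y) L.length) RT L[i] i =
      ∑ j ∈ range L.length, d j * (2 ^ y) ^ j := by
    zify
    rw [rowA, hpow, Int.toNat_of_nonneg (by exact_mod_cast hnn)]
    push_cast
    have hsum' := hsum
    push_cast at hsum'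
    rw [hsum', ← Fin.sum_univ_eq_sum_range]
    refine Finset.sum_congr rfl fun j _ => ?_
    rw [hdcast j]
    push_cast
    ring
  -- read the field
  rw [PSD.Packed.entry, hrowN, Nat.shiftRight_eq_div_pow, show 2 ^ (y * (j : ℕ)) = (2 ^ y) ^ (j : ℕ) by
    rw [← pow_mul], PSD.Packed.digit_of_expansion hYpos L.length d hdlt j, if_pos j.isLt, hdcast j, hA]
  ring

end Rows

end CodedCluster

end OccupationCode

end Literature.MathematicalPhysics.QuantumLattice
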